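import Summits.ValiantsHypothesis.ValiantsHypothesis.Theorems.LacunarySymmetroidMatrixDescartesCensusLaguerreClosed
import Summits.ValiantsHypothesis.ValiantsHypothesis.Theorems.LacunarySymmetroidMatrixDescartesCensusEnvelopeSetup

/-!
# `DoorA26` census — LAGUERRE ROWS OF A HYPOTHETICAL TWENTY: `20 ≤ V(bottom partial sums at t) + V(top partial sums at t)`

HONEST FRAMING.  Object-search cell `pub-symmetroid`, seat `val-sym-door-p1` (gen 12); helper file `--supports`
stmt-ValiantsHypothesis-19979 (`DoorA26 := PosRootLawAt 2 6 19`, OPEN, typed, never asserted).  A NECESSARY CONDITION on a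
hypothetical twenty (root-side row family for the line `census`, stub `stub_hardChambers`); nothing here bounds `ζ_sym(2,6)`;
registers unchanged; nothing bears on `MatrixDescartes` (stmt-ValiantsHypothesis-18050) or on `VP ≠ VNP`.

CONTENT.  `laguerre_rows_of_alternating`: if a real polynomial `f` (`natDegree f ≤ N`) alternates in sign along increasing positive
points `M 0 < ⋯ < M n` (non-zeros), then at EVERY `t > 0` with `f(t) ≠ 0`: `n ≤ V(S_0(t),…,S_N(t)) + V(T_0(t),…,T_N(t))` (bottom /
top partial sums of `f` at `t`; closed Laguerre rules of `…CensusLaguerreClosed` on the points below / above `t`, junction additivity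
and sublist monotonicity of `sgnChanges`).  `laguerre_rows_of_twenty`: for a real symmetric `2 × 2` six-term pencil with twenty
positive det-roots (the currency of `…CensusEnvelopeSetup.twenty_midpoints`), at every `t > 0` off the roots
`20 ≤ V(S(t)) + V(T(t))` — at fixed rational `t` a finite disjunction of LINEAR sign conditions on the 21 coefficients, a root-side
row beyond the Newton cone (located, seat memo DOOR-A26-P1G12-LAGUERRE.md: violated at `t = 161/32` by the kernel pseudo-twenty of
`…CensusPseudoTwenty000203081933`, which passes all sign + C25 + Gram rows). [cite: Laguerre1883, the partial-sum rules]; axioms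
standard; no definitions.
-/

set_option linter.dupNamespace false
set_option autoImplicit false

namespace Summit.ValiantsHypothesis.ValiantsHypothesis.Theorems.LacunarySymmetroidMatrixDescartes.Census

open Polynomial
open Summit.ValiantsHypothesis.ValiantsHypothesis.Theorems.KPlusLogSqLaw.WindowDescartes

section LaguerreTwenty

/-! ### §3 Laguerre rows of an alternating configuration -/

/-- **LAGUERRE ROWS OF AN ALTERNATING CONFIGURATION.**  If the real polynomial `f` (`natDegree f ≤ N`) alternates in sign
along increasing positive points `M 0 < M 1 < ⋯ < M n`, then at every `t > 0` with `f(t) ≠ 0`: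
`n ≤ V(S_0(t), …, S_N(t)) + V(T_0(t), …, T_N(t))` (bottom and top partial sums of `f` at `t`).  [this file] -/
theorem laguerre_rows_of_alternating (f : ℝ[X]) {N : ℕ} (hN : f.natDegree ≤ N) (n : ℕ) (M : ℕ → ℝ)
    (hM0 : ∀ i, 0 < M i) (hMmono : ∀ i j, i < j → M i < M j) (hMne : ∀ i, f.eval (M i) ≠ 0)
    (halt : ∀ i, 0 < i → i ≤ n → f.eval (M (i - 1)) * f.eval (M i) < 0)
    {t : ℝ} (ht : 0 < t) (hft : f.eval t ≠ 0) :
    n ≤ sgnChanges (slist (fun m => ∑ k ∈ Finset.range (m + 1), f.coeff k * t ^ k) N)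
        + sgnChanges (slist (fun m => ∑ k ∈ Finset.Ico m (N + 1), f.coeff k * t ^ k) N) := by
  classical
  -- `j` = the number of sample points below `t`
  have hex : ∃ j, n < j ∨ t ≤ M j := ⟨n + 1, Or.inl (Nat.lt_succ_self n)⟩
  set j := Nat.find hex with hj
  have hjspec : n < j ∨ t ≤ M j := Nat.find_spec hex
  have hjmin : ∀ i, i < j → i ≤ n ∧ M i < t := fun i hi => by
    have h' : ¬ (n < i ∨ t ≤ M i) := Nat.find_min hex (hj ▸ hi)
    exact ⟨not_lt.mp (fun h => h' (Or.inl h)), not_le.mp (fun h => h' (Or.inr h))⟩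
  have hjn : j ≤ n + 1 := by
    by_contra h
    have := (hjmin (n + 1) (by omega)).1
    omega
  -- `j'` = the first index of a sample point above `t` (skipping a sample point equal to `t`)
  set j' := (if j ≤ n ∧ M j = t then j + 1 else j) with hj'
  have hjj' : j ≤ j' := by rw [hj']; split_ifs <;> omega
  have hj'n : j' ≤ n + 1 := by
    rw [hj']; split_ifs with h
    · omega
    · exact hjn
  have habove : ∀ i, j' ≤ i → i ≤ n → t < M i := by
    intro i hi hin
    have hjle : j ≤ n := by omega
    have htj : t ≤ M j := hjspec.resolve_left (by omega)
    rw [hj'] at hi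
    split_ifs at hi with h
    · exact lt_of_le_of_lt htj (hMmono j i (by omega))
    · rcases (show j = i ∨ j < i by omega) with rfl | hlt
      · exact lt_of_le_of_ne htj (fun e => h ⟨hjle, e.symm⟩)
      · exact lt_of_le_of_lt htj (hMmono j i hlt)
  have hmid : ∀ i, j ≤ i → i < j' → M i = t := by
    intro i hi hi'
    rw [hj'] at hi'
    split_ifs at hi' with h
    · have : i = j := by omega
      rw [this]; exact h.2
    · omega
  -- the two sample lists
  set B := (List.range j).map M with hB
  set A := (List.range (n + 1 - j')).map (fun i => M (j' + i)) with hA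
  have hBsort : B.Pairwise (· < ·) := by
    rw [hB, List.pairwise_map]
    exact List.pairwise_lt_range.imp (fun {a b} hab => hMmono a b hab)
  have hAsort : A.Pairwise (· < ·) := by
    rw [hA, List.pairwise_map]
    exact List.pairwise_lt_range.imp (fun {a b} hab => hMmono _ _ (by omega))
  have hB0 : ∀ x ∈ B, 0 < x := by
    intro x hx; rw [hB, List.mem_map] at hx; obtain ⟨i, _, rfl⟩ := hx; exact hM0 i
  have hBt : ∀ x ∈ B, x < t := by
    intro x hx; rw [hB, List.mem_map] at hx; obtain ⟨i, hi, rfl⟩ := hx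
    rw [List.mem_range] at hi; exact (hjmin i hi).2
  have hBne : ∀ x ∈ B, f.eval x ≠ 0 := by
    intro x hx; rw [hB, List.mem_map] at hx; obtain ⟨i, _, rfl⟩ := hx; exact hMne i
  have hAt : ∀ x ∈ A, t < x := by
    intro x hx; rw [hA, List.mem_map] at hx; obtain ⟨i, hi, rfl⟩ := hx
    rw [List.mem_range] at hi; exact habove (j' + i) (by omega) (by omega)
  have hAne : ∀ x ∈ A, f.eval x ≠ 0 := by
    intro x hx; rw [hA, List.mem_map] at hx; obtain ⟨i, _, rfl⟩ := hx; exact hMne _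
  have h1 := laguerre_sgnChanges_below_closed f hN ht B hBsort hB0 hBt hBne hft
  have h2 := laguerre_sgnChanges_above_closed f hN ht A hAsort hAt hAne hft
  rw [List.map_append, List.map_singleton] at h1
  rw [List.map_cons] at h2
  -- the three value blocks
  set g : ℕ → ℝ := fun i => f.eval (M i) with hg
  set Bv := (List.range j).map g with hBv
  set Mv := (List.range (j' - j)).map (fun i => g (j + i)) with hMv
  set Av := (List.range (n + 1 - j')).map (fun i => g (j' + i)) with hAv
  have hBmap : B.map (fun x => f.eval x) = Bv := by rw [hB, hBv, List.map_map]; rfl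
  have hAmap : A.map (fun x => f.eval x) = Av := by rw [hA, hAv, List.map_map]; rfl
  rw [hBmap] at h1
  rw [hAmap] at h2
  have hjunc := sgnChanges_append_junction Bv Av hft
  -- the full value list, split into the three blocks
  have hfull : sgnChanges ((List.range (n + 1)).map g) = n :=
    sgnChanges_map_range_of_alternating g n (fun i hi => halt (i + 1) (Nat.succ_pos i) (by omega))
  have hsplit : (List.range (n + 1)).map g = Bv ++ (Mv ++ Av) := by
    have e2 : List.range (n + 1) = List.range j ++ (List.range (n + 1 - j)).map (fun i => j + i) := by
      rw [← List.range_add]; congr 1; omega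
    have e3 : List.range (n + 1 - j) = List.range (j' - j) ++ (List.range (n + 1 - j')).map (fun i => (j' - j) + i) := by
      rw [← List.range_add]; congr 1; omega
    rw [e2, List.map_append, List.map_map, e3, List.map_append, List.map_map, hBv, hMv, hAv]
    congr 2
    refine List.map_congr_left fun i _ => ?_
    show g (j + ((j' - j) + i)) = g (j' + i)
    congr 1; omega
  -- the middle block has at most one element, of value `f t`
  have hMv_sub : Mv.Sublist [f.eval t] := by
    rcases Nat.eq_zero_or_pos (j' - j) with h0 | hpos
    · rw [hMv, h0]; simp
    · have h1' : j' - j = 1 := by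
        rw [hj'] at hpos ⊢; split_ifs at hpos ⊢ <;> omega
      rw [hMv, h1', List.range_one, List.map_singleton, Nat.add_zero]
      have : g j = f.eval t := by show f.eval (M j) = f.eval t; rw [hmid j le_rfl (by omega)]
      rw [this]
  have hsub : ((List.range (n + 1)).map g).Sublist (Bv ++ f.eval t :: Av) := by
    rw [hsplit, show Bv ++ f.eval t :: Av = Bv ++ ([f.eval t] ++ Av) from rfl]
    exact (List.Sublist.refl Bv).append (hMv_sub.append (List.Sublist.refl Av))
  have hmono := sgnChanges_le_of_sublist hsub
  rw [hfull, ← hjunc] at hmono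
  exact hmono.trans (Nat.add_le_add h1 h2)

/-! ### §4 Laguerre rows of a hypothetical twenty -/

/-- **LAGUERRE ROWS OF A HYPOTHETICAL TWENTY** (symmetric letters, ANY support).  If a real symmetric `2 × 2` six-term pencil
has twenty positive det-roots `r 0 < ⋯ < r 19`, then at EVERY test abscissa `t > 0` with `det F(t) ≠ 0` the bottom and top
partial sums of `det F` at `t` satisfy `20 ≤ V(S_0(t),…,S_N(t)) + V(T_0(t),…,T_N(t))` (`N ≥ natDegree`; `S_m(t) = ∑_{k ≤ m}
coeff k · t^k`, `T_m(t) = ∑_{m ≤ k ≤ N} coeff k · t^k`).  At fixed rational `t` this is a finite disjunction of LINEAR sign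
conditions on the 21 coefficients — a root-side row beyond the Newton cone (it fails at `t = 161/32` for the kernel pseudo-twenty of
`…CensusPseudoTwenty000203081933`, located).  [this file; cite: Laguerre1883, the partial-sum rules] -/
theorem laguerre_rows_of_twenty (d : Fin 6 → ℕ) (S : Fin 6 → Matrix (Fin 2) (Fin 2) ℝ) (hS : ∀ l, (S l).IsSymm)
    (r : Fin 20 → ℝ) (hr : StrictMono r) (hr0 : ∀ k, 0 < r k)
    (hroot : ∀ k, r k ∈ (Matrix.det (∑ l, ((X : ℝ[X]) ^ d l) • (S l).map C)).roots)
    {N : ℕ} (hN : (Matrix.det (∑ l, ((X : ℝ[X]) ^ d l) • (S l).map C)).natDegree ≤ N)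
    {t : ℝ} (ht : 0 < t) (hft : (Matrix.det (∑ l, ((X : ℝ[X]) ^ d l) • (S l).map C)).eval t ≠ 0) :
    20 ≤ sgnChanges (slist (fun m => ∑ k ∈ Finset.range (m + 1),
            (Matrix.det (∑ l, ((X : ℝ[X]) ^ d l) • (S l).map C)).coeff k * t ^ k) N)
        + sgnChanges (slist (fun m => ∑ k ∈ Finset.Ico m (N + 1),
            (Matrix.det (∑ l, ((X : ℝ[X]) ^ d l) • (S l).map C)).coeff k * t ^ k) N) := by
  obtain ⟨R, M, _, hM0, hMmono, hMne, halt, _⟩ := twenty_midpoints d S hS r hr hr0 hroot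
  exact laguerre_rows_of_alternating _ hN 20 M hM0 hMmono hMne halt ht hft

end LaguerreTwenty

end Summit.ValiantsHypothesis.ValiantsHypothesis.Theorems.LacunarySymmetroidMatrixDescartes.Census
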